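import Mathlib

/-!
# PercRepro — S2: THE FIBRE-WEIGHT SUM OF THEOREM M's MULTIPLICITY, IN CLOSED FORM
(p4, gen 17; the sequel of S2MultWeightSums; paper proofs/P4-gen17.md §5; a feeder for the S4 rows `q ≥ 10`, owner p9)

THEOREM M gives the multiplicity `L(ν) = j₀·(C(ν, j₀) − (2^{j₀−1} − j₀)·C(ν, j₀−1))` (S2IndepCount). For the weights
`Σ_j C(F, j)/L(j + 1)`:
* `sum_range_choose_div_choose_add_le`: `Σ_{j<N} C(F, j)/C(j + s, s) ≤ 2^{F+s}/C(F + s, s)` (the identity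
  `C(F, j)·C(F + s, s) = C(F + s, j + s)·C(j + s, s)`; the `s = 3, 4` cases are S2MultWeightSums);
* `choose_ratio_antitone`: `C(J + 1, j₀)·C(j + j₀, j₀) ≤ C(J + j₀, j₀)·C(j + 1, j₀)` for `J ≤ j` — the ratio
  `C(j + j₀, j₀)/C(j + 1, j₀)` decreases in `j`, so on `j ≥ J` the denominator `C(j + 1, j₀)` of the weight is at least
  `C(j + j₀, j₀)/ρ(J)` with the explicit `ρ(J) = C(J + j₀, j₀)/C(J + 1, j₀)` (`sum_Ico_choose_div_choose_succ_le`);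
* `mul_choose_le_two_mul_indepBound`: `j₀·C(ν, j₀) ≤ 2·L(ν)` once `ν ≥ (2(2^{j₀−1} − j₀) + 1)·j₀` (the identity
  `C(ν, j₀)·j₀ = C(ν, j₀ − 1)·(ν − j₀ + 1)`).
Hence, for `J ≥ (2(2^{j₀−1} − j₀) + 1)·j₀ − 1`:
`Σ_{j<N} C(F, j)/max(cube, L)(j + 1) ≤ Σ_{j<J} C(F, j)/cube(j + 1) + (2ρ(J)/j₀)·2^{F+j₀}/C(F + j₀, j₀)`
(the assembly is the user's). Axioms: standard.
-/

namespace PercRepro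

namespace S2

/-- `C(F, j) · C(F + s, s) = C(F + s, j + s) · C(j + s, s)`. -/
theorem choose_mul_choose_add' (F j s : ℕ) :
    F.choose j * (F + s).choose s = (F + s).choose (j + s) * (j + s).choose s := by
  have h := Nat.choose_mul (n := F + s) (k := j + s) (s := s) (by omega)
  rw [show F + s - s = F by omega, show j + s - s = j by omega] at h
  rw [h, mul_comm]

/-- `∑_{j < N} C(n, j + s) ≤ 2^n`. -/
theorem sum_range_choose_add_le' (n N s : ℕ) : ∑ j ∈ Finset.range N, n.choose (j + s) ≤ 2 ^ n := by
  have h1 : ∑ j ∈ Finset.range N, n.choose (j + s) = ∑ k ∈ Finset.Ico s (N + s), n.choose k := by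
    rw [Finset.sum_Ico_eq_sum_range, show N + s - s = N by omega]
    apply Finset.sum_congr rfl
    intro j _
    rw [add_comm s j]
  rw [h1]
  calc ∑ k ∈ Finset.Ico s (N + s), n.choose k ≤ ∑ k ∈ Finset.range (N + s), n.choose k :=
      Finset.sum_le_sum_of_subset_of_nonneg (fun k hk => Finset.mem_range.2 (Finset.mem_Ico.1 hk).2)
        (fun _ _ _ => Nat.zero_le _)
    _ ≤ 2 ^ n := by
      rcases Nat.lt_or_ge (n + 1) (N + s) with h | h
      · rw [← Finset.sum_range_add_sum_Ico _ h.le, Nat.sum_range_choose]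
        have h0 : ∑ k ∈ Finset.Ico (n + 1) (N + s), n.choose k = 0 :=
          Finset.sum_eq_zero (fun k hk => Nat.choose_eq_zero_of_lt (by have := (Finset.mem_Ico.1 hk).1; omega))
        rw [h0, add_zero]
      · calc ∑ k ∈ Finset.range (N + s), n.choose k ≤ ∑ k ∈ Finset.range (n + 1), n.choose k :=
            Finset.sum_le_sum_of_subset_of_nonneg (Finset.range_subset_range.2 h) (fun _ _ _ => Nat.zero_le _)
          _ = 2 ^ n := Nat.sum_range_choose n

/-- **THE WEIGHT SUM WITH THE DENOMINATOR `C(j + s, s)`**: `∑_{j<N} C(F, j)/C(j + s, s) ≤ 2^{F+s}/C(F + s, s)`. -/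
theorem sum_range_choose_div_choose_add_le (F N s : ℕ) :
    ∑ j ∈ Finset.range N, (F.choose j : ℚ) / ((j + s).choose s : ℚ) ≤ 2 ^ (F + s) / ((F + s).choose s : ℚ) := by
  have hCs : (0 : ℚ) < ((F + s).choose s : ℚ) := by exact_mod_cast Nat.choose_pos (by omega : s ≤ F + s)
  have hterm : ∀ j ∈ Finset.range N,
      (F.choose j : ℚ) / ((j + s).choose s : ℚ) = ((F + s).choose (j + s) : ℚ) / ((F + s).choose s : ℚ) := by
    intro j _
    have hcs : (0 : ℚ) < ((j + s).choose s : ℚ) := by exact_mod_cast Nat.choose_pos (by omega : s ≤ j + s)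
    rw [div_eq_div_iff hcs.ne' hCs.ne']
    exact_mod_cast choose_mul_choose_add' F j s
  calc ∑ j ∈ Finset.range N, (F.choose j : ℚ) / ((j + s).choose s : ℚ)
      = ∑ j ∈ Finset.range N, ((F + s).choose (j + s) : ℚ) / ((F + s).choose s : ℚ) := Finset.sum_congr rfl hterm
    _ = (∑ j ∈ Finset.range N, ((F + s).choose (j + s) : ℚ)) / ((F + s).choose s : ℚ) := by rw [Finset.sum_div]
    _ ≤ 2 ^ (F + s) / ((F + s).choose s : ℚ) := by
        apply div_le_div_of_nonneg_right _ hCs.le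
        exact_mod_cast sum_range_choose_add_le' (F + s) N s

/-- **ONE STEP OF THE RATIO**: `C(j + 1 + j₀, j₀)·C(j + 1, j₀) ≤ C(j + j₀, j₀)·C(j + 2, j₀)` — the ratio
`C(j + j₀, j₀)/C(j + 1, j₀)` does not increase when `j` grows by one. -/
theorem choose_ratio_step (j j₀ : ℕ) :
    (j + 1 + j₀).choose j₀ * (j + 1).choose j₀ ≤ (j + j₀).choose j₀ * (j + 2).choose j₀ := by
  rcases Nat.lt_or_ge (j + 1) j₀ with hlt | hge
  · rw [Nat.choose_eq_zero_of_lt hlt, mul_zero]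
    exact Nat.zero_le _
  -- `C(j + 1 + j₀, j₀)·(j + 1) = C(j + j₀, j₀)·(j + j₀ + 1)` and `C(j + 2, j₀)·(j + 2 − j₀) = C(j + 1, j₀)·(j + 2)`
  have e1 := Nat.choose_mul_succ_eq (j + j₀) j₀
  rw [show j + j₀ + 1 - j₀ = j + 1 by omega] at e1
  have e2 := Nat.choose_mul_succ_eq (j + 1) j₀
  rw [show j + 1 + 1 = j + 2 by omega] at e2
  -- multiply the claim by `(j + 1)·(j + 2 − j₀) > 0` (if `j + 2 = j₀` the right factor is `0`: `C(j + 1, j₀) = 0`)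
  rcases Nat.lt_or_ge (j + 1) j₀ with h | h
  · rw [Nat.choose_eq_zero_of_lt h, mul_zero]; exact Nat.zero_le _
  have hpos : 0 < (j + 1) * (j + 2 - j₀) := Nat.mul_pos (by omega) (by omega)
  apply Nat.le_of_mul_le_mul_right _ hpos
  have e1' : (j + 1 + j₀).choose j₀ * (j + 1) = (j + j₀).choose j₀ * (j + j₀ + 1) := by
    rw [show j + 1 + j₀ = j + j₀ + 1 by omega]; exact e1.symm
  have e2' : (j + 2).choose j₀ * (j + 2 - j₀) = (j + 1).choose j₀ * (j + 2) := e2.symm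
  calc (j + 1 + j₀).choose j₀ * (j + 1).choose j₀ * ((j + 1) * (j + 2 - j₀))
      = ((j + 1 + j₀).choose j₀ * (j + 1)) * ((j + 1).choose j₀ * (j + 2 - j₀)) := by ring
    _ = ((j + j₀).choose j₀ * (j + j₀ + 1)) * ((j + 1).choose j₀ * (j + 2 - j₀)) := by rw [e1']
    _ ≤ ((j + j₀).choose j₀ * (j + 1)) * ((j + 1).choose j₀ * (j + 2)) := by
        -- `(j + j₀ + 1)·(j + 2 − j₀) ≤ (j + 1)·(j + 2)`
        have hineq : (j + j₀ + 1) * (j + 2 - j₀) ≤ (j + 1) * (j + 2) := by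
          rcases Nat.eq_zero_or_pos j₀ with hz | hz
          · subst hz; simp
          obtain ⟨t, rfl⟩ : ∃ t, j₀ = t + 1 := ⟨j₀ - 1, by omega⟩
          obtain ⟨u, rfl⟩ : ∃ u, j = t + u := ⟨j - t, by omega⟩
          rw [show t + u + 2 - (t + 1) = u + 1 by omega]
          nlinarith [Nat.zero_le t]
        calc ((j + j₀).choose j₀ * (j + j₀ + 1)) * ((j + 1).choose j₀ * (j + 2 - j₀))
            = ((j + j₀).choose j₀ * (j + 1).choose j₀) * ((j + j₀ + 1) * (j + 2 - j₀)) := by ring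
          _ ≤ ((j + j₀).choose j₀ * (j + 1).choose j₀) * ((j + 1) * (j + 2)) := Nat.mul_le_mul_left _ hineq
          _ = ((j + j₀).choose j₀ * (j + 1)) * ((j + 1).choose j₀ * (j + 2)) := by ring
    _ = (j + j₀).choose j₀ * ((j + 1).choose j₀ * (j + 2)) * (j + 1) := by ring
    _ = (j + j₀).choose j₀ * ((j + 2).choose j₀ * (j + 2 - j₀)) * (j + 1) := by rw [e2']
    _ = (j + j₀).choose j₀ * (j + 2).choose j₀ * ((j + 1) * (j + 2 - j₀)) := by ring

/-- **THE RATIO IS ANTITONE**: for `J ≤ j`, `C(J + 1, j₀)·C(j + j₀, j₀) ≤ C(J + j₀, j₀)·C(j + 1, j₀)`. -/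
theorem choose_ratio_antitone (J j j₀ : ℕ) (hJ : J ≤ j) :
    (J + 1).choose j₀ * (j + j₀).choose j₀ ≤ (J + j₀).choose j₀ * (j + 1).choose j₀ := by
  induction j, hJ using Nat.le_induction with
  | base => exact le_of_eq (mul_comm _ _)
  | succ j hJj ih =>
    have hstep := choose_ratio_step j j₀
    have hpos : 0 < (j + j₀).choose j₀ := Nat.choose_pos (by omega)
    apply Nat.le_of_mul_le_mul_left _ hpos
    calc (j + j₀).choose j₀ * ((J + 1).choose j₀ * (j + 1 + j₀).choose j₀)
        = (j + 1 + j₀).choose j₀ * ((J + 1).choose j₀ * (j + j₀).choose j₀) := by ring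
      _ ≤ (j + 1 + j₀).choose j₀ * ((J + j₀).choose j₀ * (j + 1).choose j₀) := Nat.mul_le_mul_left _ ih
      _ = (J + j₀).choose j₀ * ((j + 1 + j₀).choose j₀ * (j + 1).choose j₀) := by ring
      _ ≤ (J + j₀).choose j₀ * ((j + j₀).choose j₀ * (j + 2).choose j₀) := Nat.mul_le_mul_left _ hstep
      _ = (j + j₀).choose j₀ * ((J + j₀).choose j₀ * (j + 1 + 1).choose j₀) := by
          rw [show j + 2 = j + 1 + 1 by omega]; ring

/-- **THE TAIL OF THE WEIGHT SUM WITH THE DENOMINATOR `C(j + 1, j₀)`**, for `J + 1 ≥ j₀`: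
`∑_{j ∈ [J, N)} C(F, j)/C(j + 1, j₀) ≤ (C(J + j₀, j₀)/C(J + 1, j₀)) · 2^{F+j₀}/C(F + j₀, j₀)`. -/
theorem sum_Ico_choose_div_choose_succ_le (F N J j₀ : ℕ) (hJ : j₀ ≤ J + 1) :
    ∑ j ∈ Finset.Ico J N, (F.choose j : ℚ) / ((j + 1).choose j₀ : ℚ) ≤
      (((J + j₀).choose j₀ : ℚ) / ((J + 1).choose j₀ : ℚ)) * (2 ^ (F + j₀) / ((F + j₀).choose j₀ : ℚ)) := by
  have hJpos : (0 : ℚ) < ((J + 1).choose j₀ : ℚ) := by exact_mod_cast Nat.choose_pos hJ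
  have hterm : ∀ j ∈ Finset.Ico J N, (F.choose j : ℚ) / ((j + 1).choose j₀ : ℚ) ≤
      (((J + j₀).choose j₀ : ℚ) / ((J + 1).choose j₀ : ℚ)) * ((F.choose j : ℚ) / ((j + j₀).choose j₀ : ℚ)) := by
    intro j hj
    rw [Finset.mem_Ico] at hj
    have hjpos : (0 : ℚ) < ((j + 1).choose j₀ : ℚ) := by exact_mod_cast Nat.choose_pos (by omega)
    have hjj₀ : (0 : ℚ) < ((j + j₀).choose j₀ : ℚ) := by exact_mod_cast Nat.choose_pos (by omega)
    have hmono : ((J + 1).choose j₀ : ℚ) * ((j + j₀).choose j₀ : ℚ) ≤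
        ((J + j₀).choose j₀ : ℚ) * ((j + 1).choose j₀ : ℚ) := by exact_mod_cast choose_ratio_antitone J j j₀ hj.1
    rw [div_mul_div_comm, div_le_div_iff₀ hjpos (mul_pos hJpos hjj₀)]
    have hF : (0 : ℚ) ≤ (F.choose j : ℚ) := Nat.cast_nonneg _
    calc (F.choose j : ℚ) * (((J + 1).choose j₀ : ℚ) * ((j + j₀).choose j₀ : ℚ))
        ≤ (F.choose j : ℚ) * (((J + j₀).choose j₀ : ℚ) * ((j + 1).choose j₀ : ℚ)) := mul_le_mul_of_nonneg_left hmono hF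
      _ = ((J + j₀).choose j₀ : ℚ) * (F.choose j : ℚ) * ((j + 1).choose j₀ : ℚ) := by ring
  calc ∑ j ∈ Finset.Ico J N, (F.choose j : ℚ) / ((j + 1).choose j₀ : ℚ)
      ≤ ∑ j ∈ Finset.Ico J N, (((J + j₀).choose j₀ : ℚ) / ((J + 1).choose j₀ : ℚ)) *
          ((F.choose j : ℚ) / ((j + j₀).choose j₀ : ℚ)) := Finset.sum_le_sum hterm
    _ = (((J + j₀).choose j₀ : ℚ) / ((J + 1).choose j₀ : ℚ)) *
          ∑ j ∈ Finset.Ico J N, (F.choose j : ℚ) / ((j + j₀).choose j₀ : ℚ) := by rw [Finset.mul_sum]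
    _ ≤ (((J + j₀).choose j₀ : ℚ) / ((J + 1).choose j₀ : ℚ)) *
          ∑ j ∈ Finset.range N, (F.choose j : ℚ) / ((j + j₀).choose j₀ : ℚ) := by
        apply mul_le_mul_of_nonneg_left _ (div_nonneg (Nat.cast_nonneg _) (Nat.cast_nonneg _))
        apply Finset.sum_le_sum_of_subset_of_nonneg
        · intro j hj
          exact Finset.mem_range.2 (Finset.mem_Ico.1 hj).2
        · intro j _ _
          exact div_nonneg (Nat.cast_nonneg _) (Nat.cast_nonneg _)
    _ ≤ _ := by
        apply mul_le_mul_of_nonneg_left (sum_range_choose_div_choose_add_le F N j₀)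
          (div_nonneg (Nat.cast_nonneg _) (Nat.cast_nonneg _))

/-- **THE MULTIPLICITY OF THEOREM M IS AT LEAST HALF OF `j₀·C(ν, j₀)`** once `ν ≥ (2(2^{j₀−1} − j₀) + 1)·j₀`:
`j₀·C(ν, j₀) ≤ 2·j₀·(C(ν, j₀) − (2^{j₀−1} − j₀)·C(ν, j₀ − 1))`. -/
theorem mul_choose_le_two_mul_indepBound (ν j₀ : ℕ) (hj : 1 ≤ j₀)
    (hν : (2 * (2 ^ (j₀ - 1) - j₀) + 1) * j₀ ≤ ν) :
    j₀ * ν.choose j₀ ≤ 2 * (j₀ * (ν.choose j₀ - (2 ^ (j₀ - 1) - j₀) * ν.choose (j₀ - 1))) := by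
  set c := 2 ^ (j₀ - 1) - j₀ with hc
  -- `C(ν, j₀)·j₀ = C(ν, j₀ − 1)·(ν − j₀ + 1)`
  have e := Nat.choose_succ_right_eq ν (j₀ - 1)
  rw [show j₀ - 1 + 1 = j₀ by omega] at e
  -- `(ν − (j₀ − 1)) ≥ 2c·j₀`, hence `C(ν, j₀)·j₀ ≥ 2c·j₀·C(ν, j₀ − 1)`, hence `C(ν, j₀) ≥ 2c·C(ν, j₀ − 1)`
  have e3 : (2 * c + 1) * j₀ = 2 * (c * j₀) + j₀ := by ring
  rw [e3] at hν
  have h1 : 2 * (c * j₀) * ν.choose (j₀ - 1) ≤ ν.choose j₀ * j₀ := by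
    rw [e]
    have : 2 * (c * j₀) ≤ ν - (j₀ - 1) := by omega
    calc 2 * (c * j₀) * ν.choose (j₀ - 1) = ν.choose (j₀ - 1) * (2 * (c * j₀)) := by ring
      _ ≤ ν.choose (j₀ - 1) * (ν - (j₀ - 1)) := Nat.mul_le_mul_left _ this
  have h2 : 2 * (c * ν.choose (j₀ - 1)) ≤ ν.choose j₀ := by
    have hpos : 0 < j₀ := by omega
    apply Nat.le_of_mul_le_mul_right _ hpos
    calc 2 * (c * ν.choose (j₀ - 1)) * j₀ = 2 * (c * j₀) * ν.choose (j₀ - 1) := by ring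
      _ ≤ ν.choose j₀ * j₀ := h1
  have h3 : ν.choose j₀ ≤ 2 * (ν.choose j₀ - c * ν.choose (j₀ - 1)) := by omega
  calc j₀ * ν.choose j₀ ≤ j₀ * (2 * (ν.choose j₀ - c * ν.choose (j₀ - 1))) := Nat.mul_le_mul_left _ h3
    _ = 2 * (j₀ * (ν.choose j₀ - c * ν.choose (j₀ - 1))) := by ring

end S2

end PercRepro
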